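import Mathlib.MeasureTheory.Integral.Pi
import Literature.Probability.LatticeModels.PlaneRotatorJensenRotationBound
import HarnessLib

/-!
# Spin components of the plane rotator: component monomials, their positivity, and the
# duplicated-variable cone (toolkit for the Dunlop–Kunz–Pfister–Vuillermot component inequalities)

Topic `Literature/Probability/LatticeModels`. For the plane rotator (classical XY model) on a finite vertex set
`V` — spins `θ ∈ U(1)^V` with the Haar probability measure `torusHaar V` — write each spin in components,
`σ_i = (cos θ_i, sin θ_i) = (Re θ_i, Im θ_i)` (`spinRe i`, `spinIm i`). This file is the measure-theoretic
toolkit behind the component correlation inequalities of the companion file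
`PlaneRotatorComponentCorrelationInequality.lean` (Bricmont–Fontaine–Landau 1977, Appendix, Theorem A2:
`⟨s_A s_B⟩ ≥ ⟨s_A⟩⟨s_B⟩` and `0 ≤ ⟨s_A t_B⟩ ≤ ⟨s_A⟩⟨t_B⟩` for `s = cos θ`, `t = sin θ`; originally Dunlop 1976,
Kunz–Pfister–Vuillermot 1976), in the «duplicate variables» form of their Theorem A3:

* §1 **Component monomials** `∏_i (cos θ_i)^{p_i} (sin θ_i)^{q_i}` (`compMonomial p q`) and their
  **positivity** `∫ ∏_i cos^{p_i} sin^{q_i} dθ ≥ 0` (`integral_compMonomial_nonneg`: the torus integral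
  factorises over the sites, and on one circle `∫ cos^p sin^q ≥ 0` — zero unless `p, q` are both even, by the
  symmetries `z ↦ −z`, `z ↦ z̄` of the Haar measure; `integral_circle_re_pow_mul_im_pow_nonneg`). This is
  «Condition A» of Bricmont–Fontaine–Landau for the fixed-length single-spin measure.
* §2 **The component cone** `IsCompPos k` of functions on the duplicated torus `U(1)^V × U(1)^V` of the form
  `k(θ, θ') = ∑_j c_j F_j(θ) H_j(θ')` with `c_j ≥ 0` and `F_j, H_j` component monomials: a convex cone closed under
  products, sums, powers and truncated exponentials (`IsCompPos.mul/add/sum/pow/comp_expTrunc`), on which the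
  double Haar integral is non-negative (`IsCompPos.integral_nonneg`, Fubini: `∑ c_j (∫F_j)(∫H_j) ≥ 0`), also
  against the exponential of a cone element (`IsCompPos.integral_mul_exp_nonneg`, dominated convergence).
  Unlike Ginibre's positive kernels (`IsPosKernel`, symmetric squares `G(φ)G(ψ)`), the two halves may differ —
  this is what the sine components require.
* §3 **Ginibre's duplication in components**: for an observable `f` put `f_±(φ, ψ) = f(φψ) ± f(φψ̄)`
  (`dupPlus`, `dupMinus`; `θ = φψ`, `θ' = φψ̄`). Then `(cos θ_i)_+ = 2 cos φ_i cos ψ_i`,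
  `(cos θ_i)_− = −2 sin φ_i sin ψ_i`, `(sin θ_i)_+ = 2 sin φ_i cos ψ_i`, `(sin θ_i)_− = 2 cos φ_i sin ψ_i`, and the
  product rules `(fg)_+ = ½(f_+g_+ + f_−g_−)`, `(fg)_− = ½(f_+g_− + f_−g_+)`; hence for the component products
  `cosProd A = ∏_{i∈A} cos θ_i`, `sinProd B = ∏_{i∈B} sin θ_i` (multisets `A, B`): `(cosProd A)_+`,
  `−(cosProd A)_−`, `(sinProd B)_+`, `(sinProd B)_−` all lie in the cone (`isCompPos_dup_cosProd`,
  `isCompPos_dup_sinProd`) — the sign bookkeeping that makes `x`–`x` correlations positive and `x`–`y`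
  correlations negative.

## References

* J. Bricmont, J.-R. Fontaine, L. J. Landau, *On the uniqueness of the equilibrium state for plane rotators*,
  Comm. Math. Phys. 56 (1977) 281–296, Appendix (Theorems A2, A3; «Condition A»; duplicate variables).
  [BricmontFontaineLandau1977]
* F. Dunlop, *Correlation inequalities for multicomponent rotators*, Comm. Math. Phys. 49 (1976) 247–256. [Dunlop1976]
* H. Kunz, C.-E. Pfister, P.-A. Vuillermot, J. Phys. A 9 (1976) 1673. [KunzPfisterVuillermot1976]
* J. Ginibre, Comm. Math. Phys. 16 (1970) 310 (duplication `θ = φψ`, `θ' = φψ̄`). [Ginibre1970]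

## What this is not

No model is fixed here beyond the Haar measure of `U(1)^V`; the Gibbs weights enter only in the companion file.
Nothing about electrons; a classical toolkit.

Tree: `torusHaar`, `BondSystem`, `reChar`, `imChar`, `expTrunc`, `abs_expTrunc_le`, `tendsto_expTrunc`,
`integrable_of_continuous_compactSpace`. Mathlib: `integral_fintype_prod_eq_prod`, `integral_prod_mul`,
`integral_mul_left_eq_self`, `integral_inv_eq_self`.
-/

noncomputable section

open MeasureTheory Filter Finset TopologicalSpace
open scoped BigOperators Topology ComplexConjugate

namespace Literature.Probability.LatticeModels

namespace PlaneRotator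

/-! ## §1 Spin components and component monomials -/

section Components

variable {V : Type*}

/-- The `x`-component `cos θ_i = Re θ_i` of the plane rotator at site `i` (`s_i` of Bricmont–Fontaine–Landau).
[cite: BricmontFontaineLandau1977, Appendix Thm A2 (σ_i = (s_i, t_i) = (r_i cos φ_i, r_i sin φ_i))] -/
def spinRe (i : V) (θ : V → Circle) : ℝ :=
  ((θ i : Circle) : ℂ).re

/-- The `y`-component `sin θ_i = Im θ_i` of the plane rotator at site `i` (`t_i` of Bricmont–Fontaine–Landau).
[cite: BricmontFontaineLandau1977, Appendix Thm A2 (σ_i = (s_i, t_i) = (r_i cos φ_i, r_i sin φ_i))] -/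
def spinIm (i : V) (θ : V → Circle) : ℝ :=
  ((θ i : Circle) : ℂ).im

/-- `cos θ_i` is continuous on the torus. [cite: BricmontFontaineLandau1977, Appendix (components s_i, t_i; Condition A; duplicate variables) — plumbing] -/
@[fun_prop]
theorem continuous_spinRe (i : V) : Continuous (spinRe i : (V → Circle) → ℝ) := by
  unfold spinRe; fun_prop

/-- `sin θ_i` is continuous on the torus. [cite: BricmontFontaineLandau1977, Appendix (components s_i, t_i; Condition A; duplicate variables) — plumbing] -/
@[fun_prop]
theorem continuous_spinIm (i : V) : Continuous (spinIm i : (V → Circle) → ℝ) := by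
  unfold spinIm; fun_prop

/-- `|cos θ_i| ≤ 1`. [cite: BricmontFontaineLandau1977, Appendix (components s_i, t_i; Condition A; duplicate variables) — plumbing] -/
theorem abs_spinRe_le_one (i : V) (θ : V → Circle) : |spinRe i θ| ≤ 1 :=
  (Complex.abs_re_le_norm _).trans_eq (Circle.norm_coe _)

/-- `|sin θ_i| ≤ 1`. [cite: BricmontFontaineLandau1977, Appendix (components s_i, t_i; Condition A; duplicate variables) — plumbing] -/
theorem abs_spinIm_le_one (i : V) (θ : V → Circle) : |spinIm i θ| ≤ 1 :=
  (Complex.abs_im_le_norm _).trans_eq (Circle.norm_coe _)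

/-- `cos(θ_y − θ_x) = cos θ_x cos θ_y + sin θ_x sin θ_y`: the two-point observable `Re(θ̄_x θ_y)` in components.
[cite: BricmontFontaineLandau1977, Appendix (components s_i, t_i; Condition A; duplicate variables) — plumbing] -/
theorem reChar_diffChar_eq_components (x y : V) (θ : V → Circle) :
    reChar (diffChar x y) θ = spinRe x θ * spinRe y θ + spinIm x θ * spinIm y θ := by
  rw [reChar, diffChar_apply, Circle.coe_mul, Circle.coe_inv_eq_conj, Complex.mul_re, Complex.conj_re,
    Complex.conj_im, spinRe, spinRe, spinIm, spinIm]
  ring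

/-- `sin(θ_y − θ_x) = cos θ_x sin θ_y − sin θ_x cos θ_y`: the bond current `Im(θ̄_x θ_y)` in components.
[cite: BricmontFontaineLandau1977, Appendix (components s_i, t_i; Condition A; duplicate variables) — plumbing] -/
theorem imChar_diffChar_eq_components (x y : V) (θ : V → Circle) :
    imChar (diffChar x y) θ = spinRe x θ * spinIm y θ - spinIm x θ * spinRe y θ := by
  rw [imChar, diffChar_apply, Circle.coe_mul, Circle.coe_inv_eq_conj, Complex.mul_im, Complex.conj_re,
    Complex.conj_im, spinRe, spinRe, spinIm, spinIm]
  ring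

variable [Fintype V]

/-- The **component monomial** `∏_i (cos θ_i)^{p_i} (sin θ_i)^{q_i}` with exponents `p, q : V → ℕ`.
[cite: BricmontFontaineLandau1977, Appendix, Condition A (products of s's and t's)] -/
def compMonomial (p q : V → ℕ) (θ : V → Circle) : ℝ :=
  ∏ i, spinRe i θ ^ p i * spinIm i θ ^ q i

/-- Component monomials are continuous. [cite: BricmontFontaineLandau1977, Appendix (components s_i, t_i; Condition A; duplicate variables) — plumbing] -/
@[fun_prop]
theorem continuous_compMonomial (p q : V → ℕ) : Continuous (compMonomial p q : (V → Circle) → ℝ) := by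
  unfold compMonomial; fun_prop

/-- Component monomials multiply by adding exponents. [cite: BricmontFontaineLandau1977, Appendix (components s_i, t_i; Condition A; duplicate variables) — plumbing] -/
theorem compMonomial_mul (p q p' q' : V → ℕ) (θ : V → Circle) :
    compMonomial p q θ * compMonomial p' q' θ = compMonomial (p + p') (q + q') θ := by
  unfold compMonomial
  rw [← Finset.prod_mul_distrib]
  refine Finset.prod_congr rfl fun i _ => ?_
  simp only [Pi.add_apply, pow_add]
  ring

/-- The empty monomial is `1`. [cite: BricmontFontaineLandau1977, Appendix (components s_i, t_i; Condition A; duplicate variables) — plumbing] -/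
theorem compMonomial_zero (θ : V → Circle) : compMonomial (0 : V → ℕ) 0 θ = 1 := by
  simp [compMonomial]

/-- `cos θ_i` is the monomial with exponents `(δ_i, 0)`. [cite: BricmontFontaineLandau1977, Appendix (components s_i, t_i; Condition A; duplicate variables) — plumbing] -/
theorem compMonomial_single_left [DecidableEq V] (i : V) (θ : V → Circle) :
    compMonomial (Pi.single i 1) 0 θ = spinRe i θ := by
  unfold compMonomial
  rw [Finset.prod_eq_single i (fun j _ hj => by simp [Pi.single_eq_of_ne hj])
    (fun h => absurd (Finset.mem_univ i) h)]
  simp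

/-- `sin θ_i` is the monomial with exponents `(0, δ_i)`. [cite: BricmontFontaineLandau1977, Appendix (components s_i, t_i; Condition A; duplicate variables) — plumbing] -/
theorem compMonomial_single_right [DecidableEq V] (i : V) (θ : V → Circle) :
    compMonomial 0 (Pi.single i 1) θ = spinIm i θ := by
  unfold compMonomial
  rw [Finset.prod_eq_single i (fun j _ hj => by simp [Pi.single_eq_of_ne hj])
    (fun h => absurd (Finset.mem_univ i) h)]
  simp

/-- A function on the torus **is a component monomial**: `f = ∏_i cos^{p_i} sin^{q_i}` for some exponents.
[cite: BricmontFontaineLandau1977, Appendix, Condition A] -/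
def IsCompMonomial (f : (V → Circle) → ℝ) : Prop :=
  ∃ p q : V → ℕ, f = compMonomial p q

namespace IsCompMonomial

/-- Component monomials are closed under products. [cite: BricmontFontaineLandau1977, Appendix (components s_i, t_i; Condition A; duplicate variables) — plumbing] -/
theorem mul {f g : (V → Circle) → ℝ} (hf : IsCompMonomial f) (hg : IsCompMonomial g) :
    IsCompMonomial (fun θ => f θ * g θ) := by
  obtain ⟨p, q, rfl⟩ := hf
  obtain ⟨p', q', rfl⟩ := hg
  exact ⟨p + p', q + q', funext fun θ => compMonomial_mul p q p' q' θ⟩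

/-- The constant `1` is a component monomial. [cite: BricmontFontaineLandau1977, Appendix (components s_i, t_i; Condition A; duplicate variables) — plumbing] -/
theorem one : IsCompMonomial (fun _ : V → Circle => (1 : ℝ)) :=
  ⟨0, 0, funext fun θ => (compMonomial_zero θ).symm⟩

/-- `cos θ_i` is a component monomial. [cite: BricmontFontaineLandau1977, Appendix (components s_i, t_i; Condition A; duplicate variables) — plumbing] -/
theorem spinRe [DecidableEq V] (i : V) : IsCompMonomial (spinRe i : (V → Circle) → ℝ) :=
  ⟨Pi.single i 1, 0, funext fun θ => (compMonomial_single_left i θ).symm⟩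

/-- `sin θ_i` is a component monomial. [cite: BricmontFontaineLandau1977, Appendix (components s_i, t_i; Condition A; duplicate variables) — plumbing] -/
theorem spinIm [DecidableEq V] (i : V) : IsCompMonomial (spinIm i : (V → Circle) → ℝ) :=
  ⟨0, Pi.single i 1, funext fun θ => (compMonomial_single_right i θ).symm⟩

/-- Component monomials are continuous. [cite: BricmontFontaineLandau1977, Appendix (components s_i, t_i; Condition A; duplicate variables) — plumbing] -/
theorem continuous {f : (V → Circle) → ℝ} (hf : IsCompMonomial f) : Continuous f := by
  obtain ⟨p, q, rfl⟩ := hf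
  exact continuous_compMonomial p q

end IsCompMonomial

section Integral

variable [MeasurableSpace Circle] [BorelSpace Circle]

omit [Fintype V] in
/-- **One circle: `∫ (Re z)^p (Im z)^q dz ≥ 0`** for the Haar probability measure of `U(1)`: if `q` is odd the
inversion `z ↦ z̄` flips the sign, if `q` is even and `p` odd the rotation `z ↦ −z` does, and if both are even the
integrand is non-negative. [cite: BricmontFontaineLandau1977, Appendix, Condition A case (i) (fixed length)] -/
theorem integral_circle_re_pow_mul_im_pow_nonneg (p q : ℕ) :
    0 ≤ ∫ z, ((z : ℂ).re) ^ p * ((z : ℂ).im) ^ q ∂(Measure.haarMeasure (⊤ : PositiveCompacts Circle)) := by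
  set μ : Measure Circle := Measure.haarMeasure ⊤ with hμ
  rcases Nat.even_or_odd q with hq | hq
  · rcases Nat.even_or_odd p with hp | hp
    · exact integral_nonneg fun z => mul_nonneg (hp.pow_nonneg ((z : ℂ).re)) (hq.pow_nonneg ((z : ℂ).im))
    · have h := integral_mul_left_eq_self (μ := μ)
        (fun z : Circle => ((z : ℂ).re) ^ p * ((z : ℂ).im) ^ q) (-1)
      simp only [neg_mul, one_mul, Circle.coe_neg, Complex.neg_re, Complex.neg_im, hp.neg_pow, hq.neg_pow,
        integral_neg] at h
      linarith
  · haveI : μ.IsInvInvariant := by rw [hμ]; infer_instance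
    have h := integral_inv_eq_self (fun z : Circle => ((z : ℂ).re) ^ p * ((z : ℂ).im) ^ q) μ
    simp only [Circle.coe_inv_eq_conj, Complex.conj_re, Complex.conj_im, hq.neg_pow, mul_neg,
      integral_neg] at h
    linarith

/-- **Positivity of component monomials** («Condition A» for the plane rotator): `∫ ∏_i cos^{p_i}θ_i sin^{q_i}θ_i dθ ≥ 0`
— the torus integral factorises over the sites. [cite: BricmontFontaineLandau1977, Appendix, Condition A case (i) (fixed length)] -/
theorem integral_compMonomial_nonneg (p q : V → ℕ) : 0 ≤ ∫ θ, compMonomial p q θ ∂torusHaar V := by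
  unfold compMonomial torusHaar spinRe spinIm
  rw [integral_fintype_prod_eq_prod (fun i (z : Circle) => ((z : ℂ).re) ^ p i * ((z : ℂ).im) ^ q i)]
  exact Finset.prod_nonneg fun i _ => integral_circle_re_pow_mul_im_pow_nonneg _ _

/-- Component monomials have non-negative integral. [cite: BricmontFontaineLandau1977, Appendix, Condition A case (i)] -/
theorem IsCompMonomial.integral_nonneg {f : (V → Circle) → ℝ} (hf : IsCompMonomial f) : 0 ≤ ∫ θ, f θ ∂torusHaar V := by
  obtain ⟨p, q, rfl⟩ := hf
  exact integral_compMonomial_nonneg p q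


end Integral

end Components

/-! ## §2 The component cone on the duplicated torus -/

section Cone

variable {V : Type*} [Fintype V]

/-- `k : U(1)^V × U(1)^V → ℝ` **lies in the component cone**: `k(θ, θ') = ∑_j c_j F_j(θ) H_j(θ')` with `c_j ≥ 0` and
`F_j`, `H_j` component monomials (the structure «series with positive coefficients of products of integrals which
are all positive by Condition A» of Bricmont–Fontaine–Landau's duplicate-variable proof).
[cite: BricmontFontaineLandau1977, Appendix, proof of Thm A3 (duplicate variables)] -/
def IsCompPos (k : (V → Circle) × (V → Circle) → ℝ) : Prop :=
  ∃ (κ : Type) (_ : Fintype κ) (c : κ → ℝ) (F H : κ → (V → Circle) → ℝ),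
    (∀ j, 0 ≤ c j) ∧ (∀ j, IsCompMonomial (F j)) ∧ (∀ j, IsCompMonomial (H j)) ∧
      k = fun z => ∑ j, c j * (F j z.1 * H j z.2)

/-- A product `F(θ) H(θ')` of component monomials lies in the cone. [cite: BricmontFontaineLandau1977, Appendix (components s_i, t_i; Condition A; duplicate variables) — plumbing] -/
theorem isCompPos_monomial {F H : (V → Circle) → ℝ} (hF : IsCompMonomial F) (hH : IsCompMonomial H) :
    IsCompPos (fun z : (V → Circle) × (V → Circle) => F z.1 * H z.2) :=
  ⟨Unit, inferInstance, fun _ => 1, fun _ => F, fun _ => H, fun _ => zero_le_one, fun _ => hF, fun _ => hH,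
    funext fun z => by simp⟩

/-- A component monomial of the first variable lies in the cone. [cite: BricmontFontaineLandau1977, Appendix (components s_i, t_i; Condition A; duplicate variables) — plumbing] -/
theorem isCompPos_fst {F : (V → Circle) → ℝ} (hF : IsCompMonomial F) :
    IsCompPos (fun z : (V → Circle) × (V → Circle) => F z.1) := by
  have h := isCompPos_monomial hF IsCompMonomial.one
  simp only [mul_one] at h
  exact h

/-- A component monomial of the second variable lies in the cone. [cite: BricmontFontaineLandau1977, Appendix (components s_i, t_i; Condition A; duplicate variables) — plumbing] -/
theorem isCompPos_snd {H : (V → Circle) → ℝ} (hH : IsCompMonomial H) :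
    IsCompPos (fun z : (V → Circle) × (V → Circle) => H z.2) := by
  have h := isCompPos_monomial IsCompMonomial.one hH
  simp only [one_mul] at h
  exact h

/-- Non-negative constants lie in the cone. [cite: BricmontFontaineLandau1977, Appendix (components s_i, t_i; Condition A; duplicate variables) — plumbing] -/
theorem isCompPos_const {a : ℝ} (ha : 0 ≤ a) : IsCompPos (fun _ : (V → Circle) × (V → Circle) => a) :=
  ⟨Unit, inferInstance, fun _ => a, fun _ _ => 1, fun _ _ => 1, fun _ => ha, fun _ => IsCompMonomial.one,
    fun _ => IsCompMonomial.one, funext fun z => by simp⟩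

namespace IsCompPos

variable {k k' : (V → Circle) × (V → Circle) → ℝ}

/-- The cone is closed under addition. [cite: BricmontFontaineLandau1977, Appendix (components s_i, t_i; Condition A; duplicate variables) — plumbing] -/
theorem add (hk : IsCompPos k) (hk' : IsCompPos k') : IsCompPos (fun z => k z + k' z) := by
  obtain ⟨κ, _, c, F, H, hc, hF, hH, rfl⟩ := hk
  obtain ⟨κ', _, c', F', H', hc', hF', hH', rfl⟩ := hk'
  refine ⟨κ ⊕ κ', inferInstance, Sum.elim c c', Sum.elim F F', Sum.elim H H', ?_, ?_, ?_, funext fun z => ?_⟩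
  · rintro (j | j) <;> simp [hc, hc']
  · rintro (j | j) <;> simp [hF, hF']
  · rintro (j | j) <;> simp [hH, hH']
  · simp [Fintype.sum_sum_type]

/-- The cone is closed under multiplication (monomials multiply). [cite: BricmontFontaineLandau1977, Appendix (components s_i, t_i; Condition A; duplicate variables) — plumbing] -/
theorem mul (hk : IsCompPos k) (hk' : IsCompPos k') : IsCompPos (fun z => k z * k' z) := by
  obtain ⟨κ, _, c, F, H, hc, hF, hH, rfl⟩ := hk
  obtain ⟨κ', _, c', F', H', hc', hF', hH', rfl⟩ := hk'
  refine ⟨κ × κ', inferInstance, fun jj => c jj.1 * c' jj.2, fun jj θ => F jj.1 θ * F' jj.2 θ,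
    fun jj θ => H jj.1 θ * H' jj.2 θ, fun jj => mul_nonneg (hc _) (hc' _), fun jj => (hF _).mul (hF' _),
    fun jj => (hH _).mul (hH' _), funext fun z => ?_⟩
  simp only [Fintype.sum_prod_type, Finset.sum_mul_sum]
  refine Finset.sum_congr rfl fun i _ => Finset.sum_congr rfl fun j _ => ?_
  ring

/-- The cone is closed under multiplication by non-negative scalars. [cite: BricmontFontaineLandau1977, Appendix (components s_i, t_i; Condition A; duplicate variables) — plumbing] -/
theorem const_mul (hk : IsCompPos k) {a : ℝ} (ha : 0 ≤ a) : IsCompPos (fun z => a * k z) :=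
  (isCompPos_const ha).mul hk

/-- The cone is closed under finite sums. [cite: BricmontFontaineLandau1977, Appendix (components s_i, t_i; Condition A; duplicate variables) — plumbing] -/
theorem sum {α : Type*} {s : Finset α} {k : α → (V → Circle) × (V → Circle) → ℝ}
    (h : ∀ a ∈ s, IsCompPos (k a)) : IsCompPos (fun z => ∑ a ∈ s, k a z) := by
  classical
  induction s using Finset.induction_on with
  | empty => simp only [Finset.sum_empty]; exact isCompPos_const le_rfl
  | insert a s has ih =>
    simp only [Finset.sum_insert has]
    exact (h a (Finset.mem_insert_self a s)).add (ih fun b hb => h b (Finset.mem_insert_of_mem hb))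

/-- The cone is closed under powers. [cite: BricmontFontaineLandau1977, Appendix (components s_i, t_i; Condition A; duplicate variables) — plumbing] -/
theorem pow (hk : IsCompPos k) (n : ℕ) : IsCompPos (fun z => k z ^ n) := by
  induction n with
  | zero => simp only [pow_zero]; exact isCompPos_const zero_le_one
  | succ n ih => simp only [pow_succ]; exact ih.mul hk

/-- The cone is closed under truncated exponentials (non-negative Taylor coefficients). [cite: BricmontFontaineLandau1977, Appendix (components s_i, t_i; Condition A; duplicate variables) — plumbing] -/
theorem comp_expTrunc (hk : IsCompPos k) (N : ℕ) : IsCompPos (fun z => expTrunc N (k z)) := by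
  have : (fun z => expTrunc N (k z)) = fun z => ∑ n ∈ Finset.range N, ((Nat.factorial n : ℕ) : ℝ)⁻¹ * k z ^ n := by
    funext z; simp only [expTrunc, div_eq_inv_mul]
  rw [this]
  exact IsCompPos.sum fun n _ => (hk.pow _).const_mul (inv_nonneg.2 (Nat.cast_nonneg _))

/-- Cone elements are continuous. [cite: BricmontFontaineLandau1977, Appendix (components s_i, t_i; Condition A; duplicate variables) — plumbing] -/
theorem continuous (hk : IsCompPos k) : Continuous k := by
  obtain ⟨κ, _, c, F, H, -, hF, hH, rfl⟩ := hk
  exact continuous_finsetSum _ fun j _ =>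
    continuous_const.mul (((hF j).continuous.comp continuous_fst).mul ((hH j).continuous.comp continuous_snd))

variable [MeasurableSpace Circle] [BorelSpace Circle]

/-- **Positivity of the cone**: `∫∫ k dθ dθ' = ∑_j c_j (∫ F_j)(∫ H_j) ≥ 0` (Fubini and Condition A).
[cite: BricmontFontaineLandau1977, Appendix, proof of Thm A3] -/
theorem integral_nonneg (hk : IsCompPos k) : 0 ≤ ∫ z, k z ∂((torusHaar V).prod (torusHaar V)) := by
  obtain ⟨κ, _, c, F, H, hc, hF, hH, rfl⟩ := hk
  have hint : ∀ j, Integrable (fun z : (V → Circle) × (V → Circle) => c j * (F j z.1 * H j z.2))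
      ((torusHaar V).prod (torusHaar V)) := fun j =>
    integrable_of_continuous_compactSpace _ (continuous_const.mul
      (((hF j).continuous.comp continuous_fst).mul ((hH j).continuous.comp continuous_snd)))
  rw [integral_finsetSum _ fun j _ => hint j]
  refine Finset.sum_nonneg fun j _ => ?_
  rw [integral_const_mul, integral_prod_mul]
  exact mul_nonneg (hc j) (mul_nonneg (hF j).integral_nonneg (hH j).integral_nonneg)

/-- **Positivity against an exponential**: for `P, D` in the cone, `∫∫ P e^{D} dθ dθ' ≥ 0` — the truncations
`P · expTrunc_N(D)` lie in the cone and converge dominatedly (`|P| ≤ M_P`, `|expTrunc_N D| ≤ e^{M_D}` on the compact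
duplicated torus). [cite: BricmontFontaineLandau1977, Appendix, proof of Thm A3 («we expand the exponential in series»)] -/
theorem integral_mul_exp_nonneg {P D : (V → Circle) × (V → Circle) → ℝ} (hP : IsCompPos P) (hD : IsCompPos D) :
    0 ≤ ∫ z, P z * Real.exp (D z) ∂((torusHaar V).prod (torusHaar V)) := by
  obtain ⟨MP, hMP⟩ := isCompact_univ.exists_bound_of_continuousOn hP.continuous.continuousOn
  obtain ⟨MD, hMD⟩ := isCompact_univ.exists_bound_of_continuousOn hD.continuous.continuousOn
  have hlim : Tendsto (fun N => ∫ z, P z * expTrunc N (D z) ∂((torusHaar V).prod (torusHaar V))) atTop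
      (𝓝 (∫ z, P z * Real.exp (D z) ∂((torusHaar V).prod (torusHaar V)))) := by
    refine tendsto_integral_of_dominated_convergence (fun _ => MP * Real.exp MD) ?_ (integrable_const _) ?_ ?_
    · exact fun N => ((hP.mul (hD.comp_expTrunc N)).continuous).aestronglyMeasurable
    · refine fun N => ae_of_all _ fun z => ?_
      have h1 : ‖P z‖ ≤ MP := hMP z (Set.mem_univ z)
      have h2 : |expTrunc N (D z)| ≤ Real.exp MD := by
        refine abs_expTrunc_le ?_ N
        have := hMD z (Set.mem_univ z)
        rwa [Real.norm_eq_abs] at this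
      rw [norm_mul, Real.norm_eq_abs (expTrunc N (D z))]
      exact mul_le_mul h1 h2 (abs_nonneg _) ((norm_nonneg _).trans h1)
    · exact ae_of_all _ fun z => (tendsto_expTrunc (D z)).const_mul (P z)
  exact ge_of_tendsto' hlim fun N => (hP.mul (hD.comp_expTrunc N)).integral_nonneg

end IsCompPos

end Cone

/-! ## §3 Ginibre's duplication in components -/

section Duplication

variable {V : Type*}

/-- The **duplicated sum** `f_+(φ, ψ) = f(φψ) + f(φψ̄)` of an observable (`θ = φψ`, `θ' = φψ̄`).
[cite: Ginibre1970, main theorem (duplication θ = φ + ψ, θ' = φ − ψ)] -/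
def dupPlus (f : (V → Circle) → ℝ) (z : (V → Circle) × (V → Circle)) : ℝ :=
  f (z.1 * z.2) + f (z.1 * z.2⁻¹)

/-- The **duplicated difference** `f_−(φ, ψ) = f(φψ) − f(φψ̄)`.
[cite: Ginibre1970, main theorem (duplication θ = φ + ψ, θ' = φ − ψ)] -/
def dupMinus (f : (V → Circle) → ℝ) (z : (V → Circle) × (V → Circle)) : ℝ :=
  f (z.1 * z.2) - f (z.1 * z.2⁻¹)

/-- Product rule `(fg)_+ = ½(f_+g_+ + f_−g_−)`. [cite: BricmontFontaineLandau1977, Appendix, proof of Thm A3 («the iterated formula»)] -/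
theorem dupPlus_mul (f g : (V → Circle) → ℝ) (z : (V → Circle) × (V → Circle)) :
    dupPlus (fun θ => f θ * g θ) z = (1 / 2) * (dupPlus f z * dupPlus g z + dupMinus f z * dupMinus g z) := by
  simp only [dupPlus, dupMinus]; ring

/-- Product rule `(fg)_− = ½(f_+g_− + f_−g_+)`. [cite: BricmontFontaineLandau1977, Appendix, proof of Thm A3 («the iterated formula»)] -/
theorem dupMinus_mul (f g : (V → Circle) → ℝ) (z : (V → Circle) × (V → Circle)) :
    dupMinus (fun θ => f θ * g θ) z = (1 / 2) * (dupPlus f z * dupMinus g z + dupMinus f z * dupPlus g z) := by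
  simp only [dupPlus, dupMinus]; ring

/-- `(cos θ_i)_+ = 2 cos φ_i cos ψ_i`. [cite: Ginibre1970, plane-rotator example (cos(a+b) + cos(a−b))] -/
theorem dupPlus_spinRe (i : V) (z : (V → Circle) × (V → Circle)) :
    dupPlus (spinRe i) z = 2 * (spinRe i z.1 * spinRe i z.2) := by
  simp only [dupPlus, spinRe, Pi.mul_apply, Pi.inv_apply, Circle.coe_mul, Circle.coe_inv_eq_conj,
    Complex.mul_re, Complex.conj_re, Complex.conj_im]
  ring

/-- `(cos θ_i)_− = −2 sin φ_i sin ψ_i`. [cite: Ginibre1970, plane-rotator example (cos(a+b) − cos(a−b))] -/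
theorem dupMinus_spinRe (i : V) (z : (V → Circle) × (V → Circle)) :
    dupMinus (spinRe i) z = -(2 * (spinIm i z.1 * spinIm i z.2)) := by
  simp only [dupMinus, spinRe, spinIm, Pi.mul_apply, Pi.inv_apply, Circle.coe_mul, Circle.coe_inv_eq_conj,
    Complex.mul_re, Complex.conj_re, Complex.conj_im]
  ring

/-- `(sin θ_i)_+ = 2 sin φ_i cos ψ_i`. [cite: BricmontFontaineLandau1977, Appendix, proof of Thm A3 (t_A + t'_A)] -/
theorem dupPlus_spinIm (i : V) (z : (V → Circle) × (V → Circle)) :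
    dupPlus (spinIm i) z = 2 * (spinIm i z.1 * spinRe i z.2) := by
  simp only [dupPlus, spinRe, spinIm, Pi.mul_apply, Pi.inv_apply, Circle.coe_mul, Circle.coe_inv_eq_conj,
    Complex.mul_im, Complex.conj_re, Complex.conj_im]
  ring

/-- `(sin θ_i)_− = 2 cos φ_i sin ψ_i`. [cite: BricmontFontaineLandau1977, Appendix, proof of Thm A3 (t'_A − t_A)] -/
theorem dupMinus_spinIm (i : V) (z : (V → Circle) × (V → Circle)) :
    dupMinus (spinIm i) z = 2 * (spinRe i z.1 * spinIm i z.2) := by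
  simp only [dupMinus, spinRe, spinIm, Pi.mul_apply, Pi.inv_apply, Circle.coe_mul, Circle.coe_inv_eq_conj,
    Complex.mul_im, Complex.conj_re, Complex.conj_im]
  ring

/-- The **product of `x`-components** `s_A = ∏_{i ∈ A} cos θ_i` over a multiset of sites.
[cite: BricmontFontaineLandau1977, Appendix Thm A2 (s_A)] -/
def cosProd (A : Multiset V) (θ : V → Circle) : ℝ :=
  (A.map fun i => spinRe i θ).prod

/-- The **product of `y`-components** `t_B = ∏_{i ∈ B} sin θ_i` over a multiset of sites.
[cite: BricmontFontaineLandau1977, Appendix Thm A2 (t_B)] -/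
def sinProd (B : Multiset V) (θ : V → Circle) : ℝ :=
  (B.map fun i => spinIm i θ).prod

/-- `s_∅ = 1`. [cite: BricmontFontaineLandau1977, Appendix (components s_i, t_i; Condition A; duplicate variables) — plumbing] -/
@[simp] theorem cosProd_zero (θ : V → Circle) : cosProd 0 θ = 1 := by simp [cosProd]

/-- `t_∅ = 1`. [cite: BricmontFontaineLandau1977, Appendix (components s_i, t_i; Condition A; duplicate variables) — plumbing] -/
@[simp] theorem sinProd_zero (θ : V → Circle) : sinProd 0 θ = 1 := by simp [sinProd]

/-- `s_{a+A} = cos θ_a · s_A`. [cite: BricmontFontaineLandau1977, Appendix (components s_i, t_i; Condition A; duplicate variables) — plumbing] -/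
theorem cosProd_cons (a : V) (A : Multiset V) (θ : V → Circle) :
    cosProd (a ::ₘ A) θ = spinRe a θ * cosProd A θ := by
  simp [cosProd]

/-- `t_{b+B} = sin θ_b · t_B`. [cite: BricmontFontaineLandau1977, Appendix (components s_i, t_i; Condition A; duplicate variables) — plumbing] -/
theorem sinProd_cons (b : V) (B : Multiset V) (θ : V → Circle) :
    sinProd (b ::ₘ B) θ = spinIm b θ * sinProd B θ := by
  simp [sinProd]

/-- `s_{{a}} = cos θ_a`. [cite: BricmontFontaineLandau1977, Appendix (components s_i, t_i; Condition A; duplicate variables) — plumbing] -/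
@[simp] theorem cosProd_singleton (a : V) (θ : V → Circle) : cosProd {a} θ = spinRe a θ := by
  simp [cosProd]

/-- `t_{{b}} = sin θ_b`. [cite: BricmontFontaineLandau1977, Appendix (components s_i, t_i; Condition A; duplicate variables) — plumbing] -/
@[simp] theorem sinProd_singleton (b : V) (θ : V → Circle) : sinProd {b} θ = spinIm b θ := by
  simp [sinProd]

/-- `s_{{a,c}} = cos θ_a cos θ_c`. [cite: BricmontFontaineLandau1977, Appendix (components s_i, t_i; Condition A; duplicate variables) — plumbing] -/
theorem cosProd_pair (a c : V) (θ : V → Circle) : cosProd {a, c} θ = spinRe a θ * spinRe c θ := by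
  rw [Multiset.insert_eq_cons, cosProd_cons, cosProd_singleton]

/-- `t_{{a,c}} = sin θ_a sin θ_c`. [cite: BricmontFontaineLandau1977, Appendix (components s_i, t_i; Condition A; duplicate variables) — plumbing] -/
theorem sinProd_pair (a c : V) (θ : V → Circle) : sinProd {a, c} θ = spinIm a θ * spinIm c θ := by
  rw [Multiset.insert_eq_cons, sinProd_cons, sinProd_singleton]

/-- `s_A` is continuous. [cite: BricmontFontaineLandau1977, Appendix (components s_i, t_i; Condition A; duplicate variables) — plumbing] -/
@[fun_prop]
theorem continuous_cosProd (A : Multiset V) : Continuous (cosProd A : (V → Circle) → ℝ) := by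
  induction A using Multiset.induction_on with
  | empty => exact continuous_const.congr fun θ => (cosProd_zero θ).symm
  | cons a A ih => exact ((continuous_spinRe a).mul ih).congr fun θ => (cosProd_cons a A θ).symm

/-- `t_B` is continuous. [cite: BricmontFontaineLandau1977, Appendix (components s_i, t_i; Condition A; duplicate variables) — plumbing] -/
@[fun_prop]
theorem continuous_sinProd (B : Multiset V) : Continuous (sinProd B : (V → Circle) → ℝ) := by
  induction B using Multiset.induction_on with
  | empty => exact continuous_const.congr fun θ => (sinProd_zero θ).symm
  | cons b B ih => exact ((continuous_spinIm b).mul ih).congr fun θ => (sinProd_cons b B θ).symm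

/-- `|s_A| ≤ 1`. [cite: BricmontFontaineLandau1977, Appendix (components s_i, t_i; Condition A; duplicate variables) — plumbing] -/
theorem abs_cosProd_le_one (A : Multiset V) (θ : V → Circle) : |cosProd A θ| ≤ 1 := by
  induction A using Multiset.induction_on with
  | empty => simp
  | cons a A ih =>
    rw [cosProd_cons, abs_mul]
    exact mul_le_one₀ (abs_spinRe_le_one a θ) (abs_nonneg _) ih

/-- `|t_B| ≤ 1`. [cite: BricmontFontaineLandau1977, Appendix (components s_i, t_i; Condition A; duplicate variables) — plumbing] -/
theorem abs_sinProd_le_one (B : Multiset V) (θ : V → Circle) : |sinProd B θ| ≤ 1 := by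
  induction B using Multiset.induction_on with
  | empty => simp
  | cons b B ih =>
    rw [sinProd_cons, abs_mul]
    exact mul_le_one₀ (abs_spinIm_le_one b θ) (abs_nonneg _) ih

variable [Fintype V] [DecidableEq V]

/-- `s_A` is a component monomial. [cite: BricmontFontaineLandau1977, Appendix (components s_i, t_i; Condition A; duplicate variables) — plumbing] -/
theorem isCompMonomial_cosProd (A : Multiset V) : IsCompMonomial (cosProd A : (V → Circle) → ℝ) := by
  induction A using Multiset.induction_on with
  | empty =>
    have : (cosProd 0 : (V → Circle) → ℝ) = fun _ => 1 := funext fun θ => cosProd_zero θ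
    rw [this]; exact IsCompMonomial.one
  | cons a A ih =>
    have : (cosProd (a ::ₘ A) : (V → Circle) → ℝ) = fun θ => spinRe a θ * cosProd A θ :=
      funext fun θ => cosProd_cons a A θ
    rw [this]; exact (IsCompMonomial.spinRe a).mul ih

/-- `t_B` is a component monomial. [cite: BricmontFontaineLandau1977, Appendix (components s_i, t_i; Condition A; duplicate variables) — plumbing] -/
theorem isCompMonomial_sinProd (B : Multiset V) : IsCompMonomial (sinProd B : (V → Circle) → ℝ) := by
  induction B using Multiset.induction_on with
  | empty =>
    have : (sinProd 0 : (V → Circle) → ℝ) = fun _ => 1 := funext fun θ => sinProd_zero θ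
    rw [this]; exact IsCompMonomial.one
  | cons b B ih =>
    have : (sinProd (b ::ₘ B) : (V → Circle) → ℝ) = fun θ => spinIm b θ * sinProd B θ :=
      funext fun θ => sinProd_cons b B θ
    rw [this]; exact (IsCompMonomial.spinIm b).mul ih

/-- **Duplication of the `x`-products**: `(s_A)_+` and `−(s_A)_−` lie in the component cone (each factor
contributes `(cos θ)_+ = 2cos φ cos ψ` or `−(cos θ)_− = 2 sin φ sin ψ`; product rules).
[cite: BricmontFontaineLandau1977, Appendix, proof of Thm A3 (factors s_A + s'_A, s_A − s'_A)] -/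
theorem isCompPos_dup_cosProd (A : Multiset V) :
    IsCompPos (dupPlus (cosProd A)) ∧ IsCompPos (fun z => -dupMinus (cosProd A) z) := by
  induction A using Multiset.induction_on with
  | empty =>
    constructor
    · have : dupPlus (cosProd (0 : Multiset V)) = fun _ => (2 : ℝ) := by
        funext z; simp only [dupPlus, cosProd_zero]; norm_num
      rw [this]; exact isCompPos_const zero_le_two
    · have : (fun z => -dupMinus (cosProd (0 : Multiset V)) z) = fun _ => (0 : ℝ) := by
        funext z; simp [dupMinus]
      rw [this]; exact isCompPos_const le_rfl
  | cons a A ih =>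
    obtain ⟨ihp, ihm⟩ := ih
    have hf : (cosProd (a ::ₘ A) : (V → Circle) → ℝ) = fun θ => spinRe a θ * cosProd A θ :=
      funext fun θ => cosProd_cons a A θ
    have hp : IsCompPos (dupPlus (spinRe a : (V → Circle) → ℝ)) := by
      have : dupPlus (spinRe a : (V → Circle) → ℝ) = fun z => 2 * (spinRe a z.1 * spinRe a z.2) :=
        funext fun z => dupPlus_spinRe a z
      rw [this]
      exact (isCompPos_monomial (IsCompMonomial.spinRe a) (IsCompMonomial.spinRe a)).const_mul zero_le_two
    have hm : IsCompPos (fun z => -dupMinus (spinRe a : (V → Circle) → ℝ) z) := by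
      have : (fun z => -dupMinus (spinRe a : (V → Circle) → ℝ) z) =
          fun z => 2 * (spinIm a z.1 * spinIm a z.2) := funext fun z => by rw [dupMinus_spinRe]; ring
      rw [this]
      exact (isCompPos_monomial (IsCompMonomial.spinIm a) (IsCompMonomial.spinIm a)).const_mul zero_le_two
    rw [hf]
    constructor
    · have : dupPlus (fun θ => spinRe a θ * cosProd A θ) = fun z =>
          (1 / 2) * (dupPlus (spinRe a) z * dupPlus (cosProd A) z +
            (-dupMinus (spinRe a) z) * (-dupMinus (cosProd A) z)) := by
        funext z; rw [dupPlus_mul]; ring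
      rw [this]
      exact ((hp.mul ihp).add (hm.mul ihm)).const_mul (by norm_num)
    · have : (fun z => -dupMinus (fun θ => spinRe a θ * cosProd A θ) z) = fun z =>
          (1 / 2) * (dupPlus (spinRe a) z * (-dupMinus (cosProd A) z) +
            (-dupMinus (spinRe a) z) * dupPlus (cosProd A) z) := by
        funext z; rw [dupMinus_mul]; ring
      rw [this]
      exact ((hp.mul ihm).add (hm.mul ihp)).const_mul (by norm_num)

/-- **Duplication of the `y`-products**: `(t_B)_+` and `(t_B)_−` lie in the component cone (each factor contributes
`(sin θ)_+ = 2 sin φ cos ψ` or `(sin θ)_− = 2 cos φ sin ψ`, both with a PLUS sign).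
[cite: BricmontFontaineLandau1977, Appendix, proof of Thm A3 (factors t_A + t'_A, t'_A − t_A)] -/
theorem isCompPos_dup_sinProd (B : Multiset V) :
    IsCompPos (dupPlus (sinProd B)) ∧ IsCompPos (dupMinus (sinProd B)) := by
  induction B using Multiset.induction_on with
  | empty =>
    constructor
    · have : dupPlus (sinProd (0 : Multiset V)) = fun _ => (2 : ℝ) := by
        funext z; simp only [dupPlus, sinProd_zero]; norm_num
      rw [this]; exact isCompPos_const zero_le_two
    · have : dupMinus (sinProd (0 : Multiset V)) = fun _ => (0 : ℝ) := by
        funext z; simp [dupMinus]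
      rw [this]; exact isCompPos_const le_rfl
  | cons b B ih =>
    obtain ⟨ihp, ihm⟩ := ih
    have hf : (sinProd (b ::ₘ B) : (V → Circle) → ℝ) = fun θ => spinIm b θ * sinProd B θ :=
      funext fun θ => sinProd_cons b B θ
    have hp : IsCompPos (dupPlus (spinIm b : (V → Circle) → ℝ)) := by
      have : dupPlus (spinIm b : (V → Circle) → ℝ) = fun z => 2 * (spinIm b z.1 * spinRe b z.2) :=
        funext fun z => dupPlus_spinIm b z
      rw [this]
      exact (isCompPos_monomial (IsCompMonomial.spinIm b) (IsCompMonomial.spinRe b)).const_mul zero_le_two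
    have hm : IsCompPos (dupMinus (spinIm b : (V → Circle) → ℝ)) := by
      have : dupMinus (spinIm b : (V → Circle) → ℝ) = fun z => 2 * (spinRe b z.1 * spinIm b z.2) :=
        funext fun z => dupMinus_spinIm b z
      rw [this]
      exact (isCompPos_monomial (IsCompMonomial.spinRe b) (IsCompMonomial.spinIm b)).const_mul zero_le_two
    rw [hf]
    constructor
    · have : dupPlus (fun θ => spinIm b θ * sinProd B θ) = fun z =>
          (1 / 2) * (dupPlus (spinIm b) z * dupPlus (sinProd B) z + dupMinus (spinIm b) z * dupMinus (sinProd B) z) :=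
        funext fun z => dupPlus_mul _ _ z
      rw [this]
      exact ((hp.mul ihp).add (hm.mul ihm)).const_mul (by norm_num)
    · have : dupMinus (fun θ => spinIm b θ * sinProd B θ) = fun z =>
          (1 / 2) * (dupPlus (spinIm b) z * dupMinus (sinProd B) z + dupMinus (spinIm b) z * dupPlus (sinProd B) z) :=
        funext fun z => dupMinus_mul _ _ z
      rw [this]
      exact ((hp.mul ihm).add (hm.mul ihp)).const_mul (by norm_num)

end Duplication

end PlaneRotator

end Literature.Probability.LatticeModels
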